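import Summits.ValiantsHypothesis.ValiantsHypothesis.Theses.AnyonJets

/-!
# ValiantsHypothesis / AnyonJets — item `CrossingNestingTwist` (stmt-ValiantsHypothesis-16749)

For a perfect matching `M` of `Fin (2n)` (fixed-point-free involution),
`Σ_{openers a < Ma} (Ma − a − 1) = 2·(cr(M) + ne(M))`: the left side counts the pairs `(a, x)` with
`a < x < Ma`; the other endpoint `Mx` of the arc through `x` lies in exactly one of the four regions
`Mx < a` (crossing `(Mx, a)`), `a < Mx < x` (nesting `(a, Mx)`), `x < Mx < Ma` (nesting `(a, x)`),
`Ma < Mx` (crossing `(a, x)`), so each crossing and each nesting is counted exactly twice.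
HONEST FRAMING: a combinatorial identity supporting a dormant route; nothing here bears on `VP ≠ VNP`.
-/

-- layout Summits/ValiantsHypothesis/ValiantsHypothesis forces the duplicated namespace component
set_option linter.dupNamespace false

namespace Summit.ValiantsHypothesis.ValiantsHypothesis.Theorems.AnyonJets

open Finset

/-- **Item `CrossingNestingTwist` (stmt-ValiantsHypothesis-16749).** [folklore] -/
theorem crossingNestingTwist_proof : Theses.AnyonJets.CrossingNestingTwist := by
  unfold Theses.AnyonJets.CrossingNestingTwist
  intro n M hinv hfix
  -- Step 1: the left side counts the pairs `(a, x)` with `a < x < M a`.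
  have hL : ∑ i ∈ Finset.univ.filter (fun i : Fin (2 * n) => i < M i), ((M i : ℕ) - (i : ℕ) - 1) =
      ∑ p : Fin (2 * n) × Fin (2 * n), if p.1 < p.2 ∧ p.2 < M p.1 then 1 else 0 := by
    rw [Fintype.sum_prod_type]
    rw [Finset.sum_filter]
    refine Finset.sum_congr rfl fun a _ => ?_
    have hcount : (∑ x : Fin (2 * n), if a < x ∧ x < M a then 1 else 0) = ((M a : ℕ) - (a : ℕ) - 1) := by
      rw [← Finset.card_filter, show Finset.univ.filter (fun x : Fin (2 * n) => a < x ∧ x < M a) =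
        Finset.Ioo a (M a) by ext x; simp [Finset.mem_Ioo], Fin.card_Ioo]
    rw [hcount]
    split_ifs with h
    · rfl
    · have : (M a : ℕ) ≤ (a : ℕ) := by exact_mod_cast not_lt.1 h
      omega
  rw [hL]
  -- Step 2: split each pair according to the position of `M x`.
  have hsplit : ∀ p : Fin (2 * n) × Fin (2 * n),
      (if p.1 < p.2 ∧ p.2 < M p.1 then 1 else 0 : ℕ) =
        (if M p.2 < p.1 ∧ p.1 < p.2 ∧ p.2 < M p.1 then 1 else 0) +
        (if p.1 < M p.2 ∧ M p.2 < p.2 ∧ p.2 < M p.1 then 1 else 0) +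
        (if p.1 < p.2 ∧ p.2 < M p.2 ∧ M p.2 < M p.1 then 1 else 0) +
        (if p.1 < p.2 ∧ p.2 < M p.1 ∧ M p.1 < M p.2 then 1 else 0) := by
    rintro ⟨a, x⟩
    simp only
    have h1 : M x ≠ x := hfix x
    have h2 : M x = a → x = M a := fun h => by rw [← h, hinv]
    have h3 : M x = M a → x = a := fun h => M.injective h
    have h1' : (M x : ℕ) ≠ (x : ℕ) := fun h => h1 (Fin.ext h)
    have h2' : (M x : ℕ) = (a : ℕ) → (x : ℕ) = (M a : ℕ) := fun h => by
      rw [h2 (Fin.ext h)]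
    have h3' : (M x : ℕ) = (M a : ℕ) → (x : ℕ) = (a : ℕ) := fun h => by rw [h3 (Fin.ext h)]
    simp only [Fin.lt_def]
    split_ifs <;> omega
  simp_rw [hsplit, Finset.sum_add_distrib]
  -- Step 3: identify the four counts.
  have hS3 : (∑ p : Fin (2 * n) × Fin (2 * n), if p.1 < p.2 ∧ p.2 < M p.2 ∧ M p.2 < M p.1 then 1 else 0 : ℕ) =
      (Finset.univ.filter (fun p : Fin (2 * n) × Fin (2 * n) => p.1 < p.2 ∧ p.2 < M p.2 ∧ M p.2 < M p.1)).card := by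
    rw [Finset.card_filter]
  have hS4 : (∑ p : Fin (2 * n) × Fin (2 * n), if p.1 < p.2 ∧ p.2 < M p.1 ∧ M p.1 < M p.2 then 1 else 0 : ℕ) =
      (Finset.univ.filter (fun p : Fin (2 * n) × Fin (2 * n) => p.1 < p.2 ∧ p.2 < M p.1 ∧ M p.1 < M p.2)).card := by
    rw [Finset.card_filter]
  -- `(a, x) ↦ (M x, a)` : {M x < a < x < M a} ≃ crossings
  have hS1 : (∑ p : Fin (2 * n) × Fin (2 * n), if M p.2 < p.1 ∧ p.1 < p.2 ∧ p.2 < M p.1 then 1 else 0 : ℕ) =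
      (Finset.univ.filter (fun p : Fin (2 * n) × Fin (2 * n) => p.1 < p.2 ∧ p.2 < M p.1 ∧ M p.1 < M p.2)).card := by
    rw [← Finset.card_filter]
    refine Finset.card_nbij' (fun p => (M p.2, p.1)) (fun q => (q.2, M q.1)) (fun p hp => ?_) (fun q hq => ?_)
      (fun p hp => ?_) (fun q hq => ?_)
    · simp only [coe_filter, mem_univ, true_and, Set.mem_setOf_eq] at hp ⊢
      rw [hinv]; exact ⟨hp.1, hp.2.1, hp.2.2⟩
    · simp only [coe_filter, mem_univ, true_and, Set.mem_setOf_eq] at hq ⊢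
      rw [hinv]; exact ⟨hq.1, hq.2.1, hq.2.2⟩
    · simp [hinv]
    · simp [hinv]
  -- `(a, x) ↦ (a, M x)` : {a < M x < x < M a} ≃ nestings
  have hS2 : (∑ p : Fin (2 * n) × Fin (2 * n), if p.1 < M p.2 ∧ M p.2 < p.2 ∧ p.2 < M p.1 then 1 else 0 : ℕ) =
      (Finset.univ.filter (fun p : Fin (2 * n) × Fin (2 * n) => p.1 < p.2 ∧ p.2 < M p.2 ∧ M p.2 < M p.1)).card := by
    rw [← Finset.card_filter]
    refine Finset.card_nbij' (fun p => (p.1, M p.2)) (fun q => (q.1, M q.2)) (fun p hp => ?_) (fun q hq => ?_)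
      (fun p hp => ?_) (fun q hq => ?_)
    · simp only [coe_filter, mem_univ, true_and, Set.mem_setOf_eq] at hp ⊢
      rw [hinv]; exact ⟨hp.1, hp.2.1, hp.2.2⟩
    · simp only [coe_filter, mem_univ, true_and, Set.mem_setOf_eq] at hq ⊢
      rw [hinv]; exact ⟨hq.1, hq.2.1, hq.2.2⟩
    · simp [hinv]
    · simp [hinv]
  rw [hS1, hS2, hS3, hS4]
  ring

end Summit.ValiantsHypothesis.ValiantsHypothesis.Theorems.AnyonJets
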